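import Summits.ResolutionOfSingularities.ResolutionOfSingularities.Theses.WildQuotients
import Summits.ResolutionOfSingularities.ResolutionOfSingularities.Theorems.WildQuotientResolution.Negative.CuspAlgebra
import Summits.ResolutionOfSingularities.ResolutionOfSingularities.Theorems.WildQuotientResolution.Negative.CuspModel
import Summits.ResolutionOfSingularities.ResolutionOfSingularities.Theorems.WildQuotientResolution.Negative.CounterexampleShape
import Literature.AlgebraicGeometry.Resolution.ResolutionOfComponents
import Literature.AlgebraicGeometry.Resolution.AlterationsProofs

/-!
# Disproof of `WildQuotientResolution` (crux `stmt-ResolutionOfSingularities-15640`, route `WildQuotients`) — findings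

Standing adversary work file (cdisprove gen 1, cycle 1, 2026-08-16,
refuter-cdisprove-stmt-ResolutionOfSingularities-15640-0). Prose only in docstrings; every
`theorem` below is sorry-free unless its docstring says NEAR-MISS. Landed companions (kernel-checked,
`Theorems/WildQuotientResolution/Negative/`): `CuspAlgebra.lean` (p130236), `CuspModel.lean` (p130487),
`CounterexampleShape.lean` (p130278), `Faithful.lean` (p130636) — this file indexes them and adds the work-file-only material
(`def`initions of the dropped-hypothesis variants, positive slices, near-misses).

THE CRUX (`WQ = ∀ p prime, WQ_p`, `wildQuotientResolution_iff` is `Iff.rfl`). `WQ_p`: for every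
field `k` of characteristic `p`, every integral separated finite-type `X₁ / k` receiving a finite
surjective `q : X' → X₁`, étale over a dense open, from a REGULAR integral `X'`, with a finite group
`G` acting on `X'` (`ρ : G →* Aut X'`) so that `ρ g ≫ q = q` and the fibres of `q` are the
`G`-orbits, has a weak resolution (`Scheme.HasResolution X₁`: some proper birational `Y → X₁` with
`Y` regular).

FINDINGS (section by section).
* §A NO KILL IS POSSIBLE SHORT OF A COUNTEREXAMPLE TO RESOLUTION IN CHARACTERISTIC `p`
  (landed: `Negative.not_resolutionOfSingularities_of_not_wildQuotientResolution`,
  `Negative.not_wildQuotientResolution_iff`, `Negative.exists_dim_gt_three_of_not_wildQuotientResolution`).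
  The crux is the summit SPECIALISED to those integral `X₁` that happen to be Galois-type quotients
  of regular schemes; a witness against it is such a quotient of dimension `≥ 4` (modulo the named
  fact `CossartPiltant2019`) without ANY proper birational regular model. No reduced separated
  finite-type scheme over a field without a resolution is known in any dimension or
  characteristic (Kollár 2007 Ch. 3; the barrier `DimensionFourFrontier` is a frontier of
  TECHNIQUE, not a counterexample). Typing audit (§0): the statement elaborates (rc 0), the eleven
  hypotheses are jointly satisfiable NON-TRIVIALLY (§D), `Scheme.HasResolution` admits no junk
  witness for an integral `X₁` (empty source is excluded by density of `U` in a non-empty `X₁`;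
  prior refuter note 2026-08-16T21:39), quantifier order matches the informal text, no junk
  operators occur (no `/`, `-` on ℕ, `sSup`, `tsum`).
* §B KNOWN TRUE SLICES (proved here, positive — work file only): `X₁` regular; `dim X₁ ≤ 3`
  modulo `CossartPiltant2019` (landed as `Negative.wq_hasResolution_of_dim_le_three`); `q` an
  isomorphism over a dense open (then `q` itself is the resolution: `slice_genericallyIso`) — so the
  CONTENT of the crux sits exactly in the gap "étale but not an isomorphism over `U`", i.e. in a
  genuinely ramified group action; tame `G` over perfect `k` is Bergh–Rydh 2019 Thm 5 (support
  `TameQuotientResolution`, not formalised); linear wild quotients `𝔸⁴/G` are resolvable by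
  Demazure's cone construction over the 3-fold `Proj k[V]^G` + CP2019 + CJS embedded resolution +
  toroidal resolution (prior refuter's scope remark, paper sketch only) — so the first instances
  whose TRUTH is open are non-linearisable wild `ℤ/p`-actions at fixed points of regular 4-folds.
* §C LOAD-BEARING HYPOTHESES. Dropping any single hypothesis keeps `X₁` an integral separated
  finite-type `k`-scheme, EXCEPT `IsIntegral X₁` and the finite-type structure; so no
  `_false_without_<H>` theorem exists for the former kind without a counterexample to resolution
  (each such variant is sandwiched `summit ⇒ variant ⇒ crux`: `without*_of_resolutionOfSingularities`).
  Two of them COLLAPSE onto the summit, i.e. carry the whole dodge: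
  `Scheme.IsRegular X'` (landed: `Negative.wq_without_isRegular_iff_resolutionOfSingularities`) and
  `Function.Surjective q.base` (`withoutSurjective_iff_resolutionOfSingularities`, closed-point junk;
  the sibling SummitReduction disprover landed the same construction). `p.Prime` is decoration
  (`Negative.wq_allNat_iff`). `IsIntegral X₁` is NOT load-bearing either: the other hypotheses make
  `X₁` irreducible (image of `X'`) and generically reduced (faithfully flat descent along the étale
  locus), and a weak resolution of `(X₁)_red` is one of `X₁` (NEAR-MISS `withoutIntegralX₁_of_wq`,
  not closed: needs `X_red` and descent of reducedness in Mathlib form). `LocallyOfFiniteType`: unlike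
  for the cruxes `Pialt`/`Picover` (sibling files `FiniteTypeLoadBearing`, `ExcellenceLoadBearing`)
  no cheap witness exists — a finite cover by a regular (hence Noetherian) scheme forces `X₁`
  Noetherian (Eakin–Nagata) with finite normalisation, and in dimension `1` that already yields a
  resolution; a non-excellent 2-dimensional quotient would be needed (not attempted).
  `[Finite G]` is implied by the rest up to replacing `G` by its image (NEAR-MISS
  `finite_range_of_orbits`: `im ρ ↪ Aut(K(X')/K(X₁))`, finite since `q` is finite dominant and `X'`
  reduced separated over `X₁`), and the action may be assumed FAITHFUL (landed:
  `Negative.wqFaithful_iff` — pass to `G ⧸ ker ρ`; so inertia/stabiliser groups live in `im ρ`).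
* §D THE HYPOTHESES HAVE CONTENT — TWO NATURAL STRENGTHENINGS ARE FALSE (landed, `CuspModel.lean`):
  the cusp `q : Spec k[T] → Spec k[T², T³]`, `G = 1`, meets all eleven hypotheses over every field
  while `X₁` is not regular and `q` is not an isomorphism (`Negative.cusp_model`,
  `Negative.not_wqIsRegular`, `Negative.not_wqIsIso`): the conclusion cannot be strengthened to
  "`X₁` regular", and "`X₁ = X'/G`" holds only up to normalisation (a finite universal
  homeomorphism), exactly as the crux's docstring says. The cusp is resolved by `q` itself
  (`Negative.isResolution_q`), consistent with §B.
* §E NEAR-MISSES (sorried, work file only): `withoutIntegralX₁_of_wq`, `finite_range_of_orbits`,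
  `slice_trivialGroup` (for `G = 1` the crux should hold outright: `q` injective + finite + étale
  over dense `U` ⇒ `q` an isomorphism over a smaller dense open unless `dim X₁ = 0`, where `X₁` is
  regular anyway; missing: "finite étale and bijective on points over a positive-dimensional base
  has degree 1" — false over a 0-dimensional base, `Spec L → Spec K`).

WHY IT RESISTS. `ResolutionOfSingularities ⇒ WQ` verbatim, and `¬ WQ` is a Galois-type quotient
4-fold (or higher) without any regular proper birational model: producing one means disproving
resolution of singularities in characteristic `p`, for which not even a candidate exists in print
(Kollár 2007 Ch. 3; CossartPiltant2019 settle `dim ≤ 3`; Hauser–Perlega / kangaroo phenomena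
obstruct INVARIANTS, not existence). Every cheap attack — degenerate binders (`G = 1`, `q = 𝟙`,
closed points, `Spec L → Spec K`, empty schemes), junk resolutions, dropping hypotheses, small
explicit models (cusp; `𝔸²/±1` on paper) — lands in a true slice, in the summit itself, or in a
consistent singular model that is nevertheless resolvable.

## Sources
* J. Kollár, *Lectures on Resolution of Singularities*, Ann. Math. Stud. 166 (2007), Ch. 3.
* V. Cossart, O. Piltant, J. Algebra 529 (2019), Thm. 1.1 (named fact `CossartPiltant2019`).
* A. J. de Jong, Ann. Inst. Fourier 47 (1997), Cor. 5.15 (the alteration residue).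
* D. Bergh, D. Rydh, arXiv:1905.00872, Thm. 5 (tame quotients); F. Király, W. Lütkebohmert,
  arXiv:1001.1945, Thm. 2 (cyclic wild criterion); D. Lorenzini, Math. Z. 275 (2013) (wild quotient
  surface singularities); M. Demazure, *Anneaux gradués normaux* (1988) (cones over `Proj`).
* H. Matsumura, *Commutative Ring Theory*, Thm. 19.4 (regular ⇒ normal; in tree).
* In tree: `Theorems/SummitReduction/Negative/CounterexampleShape.lean` (sibling disprover: the
  `IsRegular X'` / `Surjective q.base` collapses inside `SummitReduction`), `Theorems/Pialt/Negative/*`,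
  `Theorems/Picover/Negative/*` (the analogous analyses for the sister cruxes).
-/

noncomputable section

-- single-problem summit: the doubled namespace component `ResolutionOfSingularities` is forced
set_option linter.dupNamespace false

open CategoryTheory AlgebraicGeometry TopologicalSpace Topology
open Literature.AlgebraicGeometry.Resolution

namespace Summit.ResolutionOfSingularities.ResolutionOfSingularities.Cruxes.WildQuotientResolution.Disproof

open Summit.ResolutionOfSingularities.ResolutionOfSingularities.Theses.WildQuotients
  (WildQuotientResolution CyclicWildQuotient TameQuotientResolution)
open Summit.ResolutionOfSingularities.ResolutionOfSingularities.Theorems.WildQuotientResolution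

/-! ## §0 The crux unfolded, prime by prime -/

/-- `WQ_p`: the body of `WildQuotientResolution` at `p`. -/
def WQAt (p : ℕ) : Prop :=
  ∀ (k : Type) [Field k] [CharP k p] (X' X₁ : Scheme.{0}) (f : X₁ ⟶ Spec (.of k)) (q : X' ⟶ X₁)
    (G : Type) [Group G] [Finite G] (ρ : G →* Aut X'), IsSeparated f → LocallyOfFiniteType f →
    QuasiCompact f → IsIntegral X₁ → IsIntegral X' → Scheme.IsRegular X' → IsFinite q →
    Function.Surjective q.base → (∃ U : X₁.Opens, Dense (U : Set X₁) ∧ Etale (q ∣_ U)) →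
    (∀ g : G, (ρ g).hom ≫ q = q) → (∀ x y : X', q.base x = q.base y → ∃ g : G, (ρ g).hom.base x = y) →
    Scheme.HasResolution X₁

/-- The crux is, verbatim, `∀ p prime, WQ_p`. -/
theorem wildQuotientResolution_iff : WildQuotientResolution ↔ ∀ p : ℕ, p.Prime → WQAt p := Iff.rfl

/-! ## §A The crux is a special case of the summit: shape of a counterexample (landed) -/

/-- `ResolutionInChar p ⇒ WQ_p` (resolve `X₁` directly). -/
theorem wqAt_of_resolutionInChar {p : ℕ} (h : ResolutionInChar.{0} p) : WQAt p := by
  intro k _ _ X' X₁ f q G _ _ ρ hs hl hq hi1 _ _ _ _ _ _ _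
  exact h k X₁ f hs hl hq inferInstance

/-- **The summit implies the crux** (stated contrapositively; landed as
`Negative.not_resolutionOfSingularities_of_not_wildQuotientResolution`): a disproof of the crux
disproves resolution of singularities in positive characteristic — here prime by prime through
`wqAt_of_resolutionInChar`. -/
theorem not_resolutionOfSingularities_of_not_wildQuotientResolution (h : ¬ WildQuotientResolution) :
    ¬ _root_.ResolutionOfSingularities := fun hR =>
  h fun p hp => wqAt_of_resolutionInChar ((_root_.ResolutionOfSingularities_iff.mp hR) p hp)

/-- Landed (`Negative.not_wildQuotientResolution_iff`): the exact shape of a counterexample is a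
Galois-type quotient `X₁` (all eleven hypotheses) with `¬ Scheme.HasResolution X₁`; here the
prime-by-prime form. -/
theorem not_wildQuotientResolution_iff_exists_prime :
    ¬ WildQuotientResolution ↔ ∃ p : ℕ, p.Prime ∧ ¬ WQAt p := by
  constructor
  · intro h
    by_contra hcon
    exact h fun p hp => by_contra fun hW => hcon ⟨p, hp, hW⟩
  · rintro ⟨p, hp, hW⟩ h
    exact hW (h p hp)

/-! ## §B Known true slices (positive; work file only) -/

/-- **Slice: `X₁` regular** — nothing to do (`Scheme.IsRegular.hasResolution`). -/
theorem slice_isRegular {X₁ : Scheme.{0}} (h : Scheme.IsRegular X₁) : Scheme.HasResolution X₁ :=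
  h.hasResolution

/-- **Slice: `q` an isomorphism (not merely étale) over a dense open** — then `q` itself is a weak
resolution of `X₁`: finite ⇒ proper, the preimage of `U` is a non-empty open of the irreducible
`X'`, hence dense, and `X'` is regular. So the content of the crux lies exactly in ramified actions:
for `G` acting with trivial stabilisers over `U` the quotient map is étale but no isomorphism, and
one must blow up. [folklore] -/
theorem slice_genericallyIso {X' X₁ : Scheme.{0}} (q : X' ⟶ X₁) [IsIntegral X₁] [IsIntegral X']
    (hreg : Scheme.IsRegular X') [IsFinite q] (hsurj : Function.Surjective q.base)
    (hU : ∃ U : X₁.Opens, Dense (U : Set X₁) ∧ IsIso (q ∣_ U)) : Scheme.HasResolution X₁ := by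
  obtain ⟨U, hUd, hUi⟩ := hU
  refine ⟨X', q, inferInstance, ⟨U, hUd, ?_, hUi⟩, hreg⟩
  obtain ⟨u, hu⟩ := hUd.nonempty
  obtain ⟨x, hx⟩ := hsurj u
  exact (q ⁻¹ᵁ U).isOpen.dense ⟨x, show q.base x ∈ (U : Set X₁) by rw [hx]; exact hu⟩

/-- **Slice: `dim X₁ ≤ 0`** — an integral scheme of dimension `≤ 0` is a point `Spec K`, regular;
this is the only place where "fibres = orbits + generic étaleness" does NOT pin `X₁` birationally
(`Spec L → Spec K` with `G = 1`), and it is harmless. [folklore] -/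
theorem slice_dim_le_zero {X₁ : Scheme.{0}} [IsIntegral X₁] (h : topologicalKrullDim X₁ ≤ 0) :
    Scheme.HasResolution X₁ :=
  (Scheme.IsRegular.of_topologicalKrullDim_le_zero h).hasResolution

/-- **Slice: `dim X₁ ≤ 3`** modulo `CossartPiltant2019` (landed as
`Negative.wq_hasResolution_of_dim_le_three`), prime by prime. -/
theorem slice_dim_le_three (hCP : CossartPiltant2019.{0}) (p : ℕ) :
    ∀ (k : Type) [Field k] [CharP k p] (X' X₁ : Scheme.{0}) (f : X₁ ⟶ Spec (.of k)) (q : X' ⟶ X₁)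
      (G : Type) [Group G] [Finite G] (_ρ : G →* Aut X'), IsSeparated f → LocallyOfFiniteType f →
      QuasiCompact f → IsIntegral X₁ → topologicalKrullDim X₁ ≤ 3 → Scheme.HasResolution X₁ := by
  intro k _ _ X' X₁ f q G _ _ ρ hs hl hq hi1 hdim
  exact Negative.wq_hasResolution_of_dim_le_three hCP (p := p) X₁ f hdim

/-! ## §C Load-bearing hypotheses -/

/-- The crux with `Scheme.IsRegular X'` DELETED. -/
def WildQuotientResolutionWithoutRegular : Prop :=
  ∀ p : ℕ, p.Prime → ∀ (k : Type) [Field k] [CharP k p] (X' X₁ : Scheme.{0})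
    (f : X₁ ⟶ Spec (.of k)) (q : X' ⟶ X₁) (G : Type) [Group G] [Finite G] (ρ : G →* Aut X'),
    IsSeparated f → LocallyOfFiniteType f → QuasiCompact f → IsIntegral X₁ → IsIntegral X' →
    IsFinite q → Function.Surjective q.base →
    (∃ U : X₁.Opens, Dense (U : Set X₁) ∧ Etale (q ∣_ U)) → (∀ g : G, (ρ g).hom ≫ q = q) →
    (∀ x y : X', q.base x = q.base y → ∃ g : G, (ρ g).hom.base x = y) →
    Scheme.HasResolution X₁

/-- **`Scheme.IsRegular X'` carries the whole dodge** (landed): without it the crux IS the summit. -/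
theorem withoutRegular_iff_resolutionOfSingularities :
    WildQuotientResolutionWithoutRegular ↔ _root_.ResolutionOfSingularities :=
  Negative.wq_without_isRegular_iff_resolutionOfSingularities

/-- The crux with `Function.Surjective q.base` DELETED. -/
def WildQuotientResolutionWithoutSurjective : Prop :=
  ∀ p : ℕ, p.Prime → ∀ (k : Type) [Field k] [CharP k p] (X' X₁ : Scheme.{0})
    (f : X₁ ⟶ Spec (.of k)) (q : X' ⟶ X₁) (G : Type) [Group G] [Finite G] (ρ : G →* Aut X'),
    IsSeparated f → LocallyOfFiniteType f → QuasiCompact f → IsIntegral X₁ → IsIntegral X' →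
    Scheme.IsRegular X' → IsFinite q →
    (∃ U : X₁.Opens, Dense (U : Set X₁) ∧ Etale (q ∣_ U)) → (∀ g : G, (ρ g).hom ≫ q = q) →
    (∀ x y : X', q.base x = q.base y → ∃ g : G, (ρ g).hom.base x = y) →
    Scheme.HasResolution X₁

/-- **`Function.Surjective q.base` excludes the closed-point junk**: without it the crux IS the
summit again — for an integral `X` with a closed point `x` and `X ≠ {x}` take `X' = Spec κ(x)`
(one point: integral, regular), `q` the closed immersion (finite), `G = 1`, `U = X ∖ {x}` (dense,
EMPTY preimage, so `q` is étale over it); if `X = {x}` then `X` is zero-dimensional hence regular.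
(Construction of the sibling SummitReduction disprover, `Theorems/SummitReduction/Negative/
CounterexampleShape.lean`, recast as an `↔` with the summit.) [folklore] -/
theorem withoutSurjective_iff_resolutionOfSingularities :
    WildQuotientResolutionWithoutSurjective ↔ _root_.ResolutionOfSingularities := by
  constructor
  · intro h
    refine _root_.ResolutionOfSingularities_iff.mpr fun p hp k _ _ X f hs hl hq hr => ?_
    haveI := hl; haveI := hq; haveI := hr
    refine hasResolution_of_forall_closeds X f fun Z hZ => ?_
    haveI := hZ; haveI := hs
    set Y := (Scheme.IdealSheafData.vanishingIdeal Z).subscheme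
    set g : Y ⟶ Spec (.of k) := (Scheme.IdealSheafData.vanishingIdeal Z).subschemeι ≫ f
    haveI : CompactSpace Y := QuasiCompact.compactSpace_of_compactSpace g
    obtain ⟨x, -, hx⟩ :=
      (isClosed_univ : IsClosed (Set.univ : Set Y)).exists_closed_singleton Set.univ_nonempty
    by_cases hY : ∃ y : Y, y ≠ x
    · haveI : IsClosedImmersion (Y.fromSpecResidueField x) :=
        isClosed_singleton_iff_isClosedImmersion.mp hx
      let U : Y.Opens := ⟨{x}ᶜ, hx.isOpen_compl⟩
      have hU : Dense (U : Set Y) := by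
        obtain ⟨y, hy⟩ := hY
        exact U.isOpen.dense ⟨y, Set.mem_compl_singleton_iff.mpr hy⟩
      haveI : IsEmpty (↑((Y.fromSpecResidueField x) ⁻¹ᵁ U) : Scheme.{0}) := ⟨fun s => by
        have h1 : (Y.fromSpecResidueField x).base s.1 ∈ (U : Set Y) := s.2
        have h2 : (Y.fromSpecResidueField x).base s.1 = x := Y.fromSpecResidueField_apply x s.1
        rw [h2] at h1
        exact h1 rfl⟩
      have h1 : ∀ g' : PUnit.{1},
          ((1 : PUnit.{1} →* Aut (Spec (Y.residueField x))) g').hom = 𝟙 _ := fun _ => rfl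
      refine h p hp k _ Y g (Y.fromSpecResidueField x) PUnit 1 inferInstance inferInstance
        inferInstance hZ inferInstance
        (Scheme.IsRegular.of_topologicalKrullDim_le_zero
          (topologicalKrullDim_zero_of_discreteTopology _))
        inferInstance ⟨U, hU, inferInstance⟩ (fun g' => by rw [h1, Category.id_comp]) ?_
      intro a b _
      exact ⟨1, Subsingleton.elim _ _⟩
    · push Not at hY
      haveI : Subsingleton Y := ⟨fun a b => (hY a).trans (hY b).symm⟩
      exact (Scheme.IsRegular.of_topologicalKrullDim_le_zero
        (topologicalKrullDim_zero_of_discreteTopology _)).hasResolution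
  · intro hR p hp k _ _ X' X₁ f q G _ _ ρ hs hl hq hi1 _ _ _ _ _ _
    exact (_root_.ResolutionOfSingularities_iff.mp hR) p hp k X₁ f hs hl hq inferInstance

/-- The crux with the generic étaleness of `q` DELETED (this lets `q` be purely inseparable: the
variant then CONTAINS Picover-type statements — radicial images of regular schemes, e.g. Zariski
hypersurfaces `z^p = f` under `Spec k[x^{1/p}, y, …]`). -/
def WildQuotientResolutionWithoutEtale : Prop :=
  ∀ p : ℕ, p.Prime → ∀ (k : Type) [Field k] [CharP k p] (X' X₁ : Scheme.{0})
    (f : X₁ ⟶ Spec (.of k)) (q : X' ⟶ X₁) (G : Type) [Group G] [Finite G] (ρ : G →* Aut X'),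
    IsSeparated f → LocallyOfFiniteType f → QuasiCompact f → IsIntegral X₁ → IsIntegral X' →
    Scheme.IsRegular X' → IsFinite q → Function.Surjective q.base →
    (∀ g : G, (ρ g).hom ≫ q = q) →
    (∀ x y : X', q.base x = q.base y → ∃ g : G, (ρ g).hom.base x = y) →
    Scheme.HasResolution X₁

/-- The crux with the whole group datum (`G`, `ρ`, invariance, fibres = orbits) DELETED: every
integral `X₁` finitely, surjectively and generically-étale covered by a regular integral `X'`. -/
def WildQuotientResolutionWithoutOrbits : Prop :=
  ∀ p : ℕ, p.Prime → ∀ (k : Type) [Field k] [CharP k p] (X' X₁ : Scheme.{0})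
    (f : X₁ ⟶ Spec (.of k)) (q : X' ⟶ X₁),
    IsSeparated f → LocallyOfFiniteType f → QuasiCompact f → IsIntegral X₁ → IsIntegral X' →
    Scheme.IsRegular X' → IsFinite q → Function.Surjective q.base →
    (∃ U : X₁.Opens, Dense (U : Set X₁) ∧ Etale (q ∣_ U)) →
    Scheme.HasResolution X₁

/-- The crux with `IsFinite q` DELETED. -/
def WildQuotientResolutionWithoutFinite : Prop :=
  ∀ p : ℕ, p.Prime → ∀ (k : Type) [Field k] [CharP k p] (X' X₁ : Scheme.{0})
    (f : X₁ ⟶ Spec (.of k)) (q : X' ⟶ X₁) (G : Type) [Group G] [Finite G] (ρ : G →* Aut X'),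
    IsSeparated f → LocallyOfFiniteType f → QuasiCompact f → IsIntegral X₁ → IsIntegral X' →
    Scheme.IsRegular X' → Function.Surjective q.base →
    (∃ U : X₁.Opens, Dense (U : Set X₁) ∧ Etale (q ∣_ U)) → (∀ g : G, (ρ g).hom ≫ q = q) →
    (∀ x y : X', q.base x = q.base y → ∃ g : G, (ρ g).hom.base x = y) →
    Scheme.HasResolution X₁

/-- The crux with `IsIntegral X'` DELETED (`X'` regular is still reduced with disjoint integral
components, permuted by `G`; the variant is the crux for the stabiliser of a dominating component —
morally equivalent, not formalised). -/
def WildQuotientResolutionWithoutIntegralX' : Prop :=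
  ∀ p : ℕ, p.Prime → ∀ (k : Type) [Field k] [CharP k p] (X' X₁ : Scheme.{0})
    (f : X₁ ⟶ Spec (.of k)) (q : X' ⟶ X₁) (G : Type) [Group G] [Finite G] (ρ : G →* Aut X'),
    IsSeparated f → LocallyOfFiniteType f → QuasiCompact f → IsIntegral X₁ →
    Scheme.IsRegular X' → IsFinite q → Function.Surjective q.base →
    (∃ U : X₁.Opens, Dense (U : Set X₁) ∧ Etale (q ∣_ U)) → (∀ g : G, (ρ g).hom ≫ q = q) →
    (∀ x y : X', q.base x = q.base y → ∃ g : G, (ρ g).hom.base x = y) →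
    Scheme.HasResolution X₁

/-- The crux with `IsIntegral X₁` DELETED. -/
def WildQuotientResolutionWithoutIntegralX₁ : Prop :=
  ∀ p : ℕ, p.Prime → ∀ (k : Type) [Field k] [CharP k p] (X' X₁ : Scheme.{0})
    (f : X₁ ⟶ Spec (.of k)) (q : X' ⟶ X₁) (G : Type) [Group G] [Finite G] (ρ : G →* Aut X'),
    IsSeparated f → LocallyOfFiniteType f → QuasiCompact f → IsIntegral X' →
    Scheme.IsRegular X' → IsFinite q → Function.Surjective q.base →
    (∃ U : X₁.Opens, Dense (U : Set X₁) ∧ Etale (q ∣_ U)) → (∀ g : G, (ρ g).hom ≫ q = q) →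
    (∀ x y : X', q.base x = q.base y → ∃ g : G, (ρ g).hom.base x = y) →
    Scheme.HasResolution X₁

/-- **Sandwich** `summit ⇒ variant ⇒ crux` for every dropped hypothesis that keeps `X₁` an integral
separated finite-type `k`-scheme: none of these hypotheses is load-bearing for TRUTH (they only
shape the MECHANISM — the Király–Lütkebohmert game needs the quotient presentation), and none of the
variants is refutable without a counterexample to resolution of singularities. [folklore] -/
theorem withoutEtale_of_resolutionOfSingularities (h : _root_.ResolutionOfSingularities) :
    WildQuotientResolutionWithoutEtale :=
  fun p hp k _ _ _ X₁ f _ _ _ _ _ hs hl hq _ _ _ _ _ _ _ =>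
    (_root_.ResolutionOfSingularities_iff.mp h) p hp k X₁ f hs hl hq inferInstance

theorem wildQuotientResolution_of_withoutEtale (h : WildQuotientResolutionWithoutEtale) :
    WildQuotientResolution :=
  fun p hp k _ _ X' X₁ f q G _ _ ρ hs hl hq hi1 hi' hreg hfin hsurj _ hinv horb =>
    h p hp k X' X₁ f q G ρ hs hl hq hi1 hi' hreg hfin hsurj hinv horb

theorem withoutOrbits_of_resolutionOfSingularities (h : _root_.ResolutionOfSingularities) :
    WildQuotientResolutionWithoutOrbits :=
  fun p hp k _ _ _ X₁ f _ hs hl hq _ _ _ _ _ _ =>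
    (_root_.ResolutionOfSingularities_iff.mp h) p hp k X₁ f hs hl hq inferInstance

theorem wildQuotientResolution_of_withoutOrbits (h : WildQuotientResolutionWithoutOrbits) :
    WildQuotientResolution :=
  fun p hp k _ _ X' X₁ f q _ _ _ _ hs hl hq hi1 hi' hreg hfin hsurj hU _ _ =>
    h p hp k X' X₁ f q hs hl hq hi1 hi' hreg hfin hsurj hU

theorem withoutFinite_of_resolutionOfSingularities (h : _root_.ResolutionOfSingularities) :
    WildQuotientResolutionWithoutFinite :=
  fun p hp k _ _ _ X₁ f _ _ _ _ _ hs hl hq _ _ _ _ _ _ _ =>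
    (_root_.ResolutionOfSingularities_iff.mp h) p hp k X₁ f hs hl hq inferInstance

theorem wildQuotientResolution_of_withoutFinite (h : WildQuotientResolutionWithoutFinite) :
    WildQuotientResolution :=
  fun p hp k _ _ X' X₁ f q G _ _ ρ hs hl hq hi1 hi' hreg _ hsurj hU hinv horb =>
    h p hp k X' X₁ f q G ρ hs hl hq hi1 hi' hreg hsurj hU hinv horb

theorem withoutIntegralX'_of_resolutionOfSingularities (h : _root_.ResolutionOfSingularities) :
    WildQuotientResolutionWithoutIntegralX' :=
  fun p hp k _ _ _ X₁ f _ _ _ _ _ hs hl hq _ _ _ _ _ _ _ =>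
    (_root_.ResolutionOfSingularities_iff.mp h) p hp k X₁ f hs hl hq inferInstance

theorem wildQuotientResolution_of_withoutIntegralX' (h : WildQuotientResolutionWithoutIntegralX') :
    WildQuotientResolution :=
  fun p hp k _ _ X' X₁ f q G _ _ ρ hs hl hq hi1 _ hreg hfin hsurj hU hinv horb =>
    h p hp k X' X₁ f q G ρ hs hl hq hi1 hreg hfin hsurj hU hinv horb

/-- Certified fragment of the `IsIntegral X₁` analysis: the remaining hypotheses already make `X₁`
IRREDUCIBLE (continuous image of the irreducible `X'` under the surjective `q`). [folklore] -/
theorem irreducibleSpace_of_cover {X' X₁ : Scheme.{0}} (q : X' ⟶ X₁) [IsIntegral X']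
    (hsurj : Function.Surjective q.base) : IrreducibleSpace X₁ := by
  have h := (IrreducibleSpace.isIrreducible_univ X').image q.base q.base.hom.continuous.continuousOn
  rw [Set.image_univ_of_surjective hsurj] at h
  exact (irreducibleSpace_def X₁).mpr h

/-- `IsIntegral X₁` dropped: the variant still implies the crux … -/
theorem wildQuotientResolution_of_withoutIntegralX₁ (h : WildQuotientResolutionWithoutIntegralX₁) :
    WildQuotientResolution :=
  fun p hp k _ _ X' X₁ f q G _ _ ρ hs hl hq _ hi' hreg hfin hsurj hU hinv horb =>
    h p hp k X' X₁ f q G ρ hs hl hq hi' hreg hfin hsurj hU hinv horb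

/-- … and, NEAR-MISS (sorried), conversely: `X₁` is irreducible as the image of the irreducible `X'`
and generically reduced (over the dense étale locus `U`, `q` is étale and surjective, so `𝒪_U → q_*𝒪`
is faithfully flat into a reduced sheaf), hence `(X₁)_red` is integral, again a Galois-type quotient
of `X'`, and a weak resolution `Y → (X₁)_red` composed with the closed immersion `(X₁)_red → X₁`
(an isomorphism over the reduced open `U`) is a weak resolution of `X₁`. So `IsIntegral X₁` is NOT
load-bearing. Obstruction to closing: the reduced closed subscheme `X_red` with its universal
property and "faithfully flat + reduced target ⇒ reduced source" are not available in the needed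
scheme-theoretic form; not attempted further (information only). -/
theorem withoutIntegralX₁_of_wildQuotientResolution (h : WildQuotientResolution) :
    WildQuotientResolutionWithoutIntegralX₁ := by
  sorry

/-! ## §D The hypotheses have content: the cusp model (landed) -/

/-- Landed (`Negative.cusp_model`): over every field the eleven hypotheses hold for the cusp
`Spec k[T] → Spec k[T², T³]` with `G = 1`, with `X₁` SINGULAR. In particular the hypotheses of
`WQ_p` are satisfiable by a non-regular `X₁` at every prime. -/
theorem hypotheses_satisfiable_singular (p : ℕ) [Fact p.Prime] :
    ∃ (k : Type) (_ : Field k) (_ : CharP k p) (X' X₁ : Scheme.{0}) (f : X₁ ⟶ Spec (.of k))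
      (q : X' ⟶ X₁) (G : Type) (_ : Group G) (_ : Finite G) (ρ : G →* Aut X'),
      IsSeparated f ∧ LocallyOfFiniteType f ∧ QuasiCompact f ∧ IsIntegral X₁ ∧ IsIntegral X' ∧
      Scheme.IsRegular X' ∧ IsFinite q ∧ Function.Surjective q.base ∧
      (∃ U : X₁.Opens, Dense (U : Set X₁) ∧ Etale (q ∣_ U)) ∧ (∀ g : G, (ρ g).hom ≫ q = q) ∧
      (∀ x y : X', q.base x = q.base y → ∃ g : G, (ρ g).hom.base x = y) ∧
      ¬ Scheme.IsRegular X₁ ∧ ¬ IsIso q ∧ Scheme.HasResolution X₁ := by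
  obtain ⟨X', X₁, f, q, ρ, hs, hl, hq, hi1, hi', hreg, hfin, hsurj, hU, hinv, horb, hnreg, hniso, hres⟩ :=
    Negative.cusp_model (ZMod p)
  exact ⟨ZMod p, inferInstance, inferInstance, X', X₁, f, q, PUnit, inferInstance, inferInstance, ρ,
    hs, hl, hq, hi1, hi', hreg, hfin, hsurj, hU, hinv, horb, hnreg, hniso, ⟨X', q, hres⟩⟩

/-- Landed (`Negative.not_wqIsRegular`): the strengthening "… ⇒ `X₁` regular" is false. -/
theorem not_strengthening_isRegular :
    ¬ (∀ p : ℕ, p.Prime → ∀ (k : Type) [Field k] [CharP k p] (X' X₁ : Scheme.{0})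
        (f : X₁ ⟶ Spec (.of k)) (q : X' ⟶ X₁) (G : Type) [Group G] [Finite G] (ρ : G →* Aut X'),
        IsSeparated f → LocallyOfFiniteType f → QuasiCompact f → IsIntegral X₁ → IsIntegral X' →
        Scheme.IsRegular X' → IsFinite q → Function.Surjective q.base →
        (∃ U : X₁.Opens, Dense (U : Set X₁) ∧ Etale (q ∣_ U)) → (∀ g : G, (ρ g).hom ≫ q = q) →
        (∀ x y : X', q.base x = q.base y → ∃ g : G, (ρ g).hom.base x = y) →
        Scheme.IsRegular X₁) :=
  Negative.not_wqIsRegular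

/-- Landed (`Negative.not_wqIsIso`): the strengthening "… ⇒ `q` an isomorphism" (`X₁ = X'/G` on
the nose) is false. -/
theorem not_strengthening_isIso :
    ¬ (∀ p : ℕ, p.Prime → ∀ (k : Type) [Field k] [CharP k p] (X' X₁ : Scheme.{0})
        (f : X₁ ⟶ Spec (.of k)) (q : X' ⟶ X₁) (G : Type) [Group G] [Finite G] (ρ : G →* Aut X'),
        IsSeparated f → LocallyOfFiniteType f → QuasiCompact f → IsIntegral X₁ → IsIntegral X' →
        Scheme.IsRegular X' → IsFinite q → Function.Surjective q.base →
        (∃ U : X₁.Opens, Dense (U : Set X₁) ∧ Etale (q ∣_ U)) → (∀ g : G, (ρ g).hom ≫ q = q) →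
        (∀ x y : X', q.base x = q.base y → ∃ g : G, (ρ g).hom.base x = y) →
        IsIso q) :=
  Negative.not_wqIsIso

/-! ## §E Near-misses (sorried; information for ideators and provers) -/

/-- NEAR-MISS: **`[Finite G]` is implied by the other hypotheses up to the image of `ρ`.** For `q`
finite surjective between integral schemes, `K(X')/K(X₁)` is a finite extension and an automorphism
of the reduced, separated-over-`X₁` scheme `X'` commuting with `q` is determined by its action on
the generic stalk, so `im ρ ↪ Aut(K(X')/K(X₁))` is finite. Not closed: needs the function-field
functor on `Aut` and "automorphisms over `X₁` agreeing generically are equal" for reduced separated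
`X'`; recorded so that planners may drop `[Finite G]` or keep it as harmless. -/
theorem finite_range_of_orbits {X' X₁ : Scheme.{0}} (q : X' ⟶ X₁) [IsIntegral X₁] [IsIntegral X']
    [IsFinite q] (hsurj : Function.Surjective q.base) (G : Type) [Group G] (ρ : G →* Aut X')
    (hinv : ∀ g : G, (ρ g).hom ≫ q = q) : Finite (MonoidHom.range ρ) := by
  sorry

/-- NEAR-MISS: **the `G = 1` slice.** With `G` trivial, fibres = orbits says `q` is injective; a
finite, surjective, injective `q` étale over a dense open `U` of a POSITIVE-dimensional integral `X₁`
should be an isomorphism over a dense open (a finite étale cover bijective on scheme points over a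
positive-dimensional base has degree one — some closed point splits), whence `slice_genericallyIso`
resolves `X₁` by `q`; if `dim X₁ = 0` then `X₁ = Spec K` is regular. Not closed: the splitting lemma
is not in the library (and is false over a zero-dimensional base, `Spec L → Spec K`). -/
theorem slice_trivialGroup (p : ℕ) :
    ∀ (k : Type) [Field k] [CharP k p] (X' X₁ : Scheme.{0}) (f : X₁ ⟶ Spec (.of k)) (q : X' ⟶ X₁),
      IsSeparated f → LocallyOfFiniteType f → QuasiCompact f → IsIntegral X₁ → IsIntegral X' →
      Scheme.IsRegular X' → IsFinite q → Function.Surjective q.base → Function.Injective q.base →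
      (∃ U : X₁.Opens, Dense (U : Set X₁) ∧ Etale (q ∣_ U)) → Scheme.HasResolution X₁ := by
  sorry

end Summit.ResolutionOfSingularities.ResolutionOfSingularities.Cruxes.WildQuotientResolution.Disproof

end
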